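import Summits.BirchSwinnertonDyer.BirchSwinnertonDyer.Theorems.ManinLocalTwoThreeTwistFamiliesFactFree
import Summits.BirchSwinnertonDyer.BirchSwinnertonDyer.Theorems.ManinLocalTwoThreeManinOddAtFourEtaTwoLattice
import Summits.BirchSwinnertonDyer.BirchSwinnertonDyer.Theorems.ManinLocalTwoThreeManinOddAtFourEtaTwoMinimalTwist
import Summits.BirchSwinnertonDyer.Rank1Residual.ManinAdditive.TwoNotDvdManinOfTwistAtTwoEdges
import Literature.NumberTheory.EllipticCurves.ManinConstantQuadraticTwistAtTwoOrdinaryProofs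
import Literature.NumberTheory.EllipticCurves.QuadraticTwistTateFormTwoProofs
import Literature.NumberTheory.EllipticCurves.QuadraticTwistJInvariantProofs
import Literature.NumberTheory.EllipticCurves.ManinConstantQuadraticTwistAtTwoProofs
import Literature.NumberTheory.EllipticCurves.NewformsTwistNewProofs
import Literature.NumberTheory.EllipticCurves.QuadraticTwistIntegralModel
import Literature.NumberTheory.EllipticCurves.QuadraticTwistMinimalModelProofs
import Literature.NumberTheory.EllipticCurves.IsogenyQuadraticTwistProofs
import Literature.NumberTheory.EllipticCurves.BSDSelmerCMPConverseMaximalOrderProofs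
import HarnessLib

/-!
# THE PRIME 2 JOINS THE TWIST GROUPOID: `|c| = 1` propagates FACT-FREE along the dyadic twists `d ∈ {−1, 2, −2}` of a
# `2`-semistable root (cell bsd-f2-manin, desc g44 MEMO-desc §69, TURNKEY T-desc-56; landed by prover seat p1 gen 25, root `63` added)

THE ENGINE (THEOREM 69.A, `abs_maninConstant_eq_one_of_twoTwist`).  `W/ℚ` globally minimal with an `X₀(M)`-datum `D` of Manin constant
`±1`, GOOD OR MULTIPLICATIVE at `2`; `d ∈ {−1, 2, −2}` with Stevens' clause (`d = −1`, or `W` multiplicative at `2`, or `a₂(W)` odd, or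
`2 ∤ M` — the last lets the supersingular-type case `η = 2` through); `W'/ℚ` globally minimal, ADDITIVE at `2`, isogenous to `W ⊗ ℚ(√d)`,
with a LATTICE-OPTIMAL `X₀(N)`-datum `D'`, `M ∣ N`, `(4|d|)² ∣ N`.  THEN `|c(D')| = 1`.  Inputs, all PROVED in the tree: the `Γ₀` twist
step `maninConstant_dvd_of_charTwist_gamma0` (`c(D') ∣ c(D)`), Stevens (5.2) at `2` (`neronLattice_quadraticTwist_two_of_etaOne`), and for
`η = 2` seat p3's `half_gaussSum_mul_mem_periodLattice_of_heckeTwo` (Hecke at `2` on the ODD level `M`), K2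
`isGloballyMinimal_quadraticTwist_two_of_even_LFunction_two` and the engine `maninConstant_dvd_mul_of_twistStep` (`r = 1`); characters
`χ₋₄, χ₈, χ₋₈` with `g(χ)² = 4d`.  NO `exists_isNewformOf`, no CDT, no Cremona table, no Stevens Thm (7.1): NO NAMED FACT.

THE FAMILIES (THEOREM 69.B).  The `2`-semistable FACT-FREE COMPLETE LEVELS `M ∈ {27, 45, 54, 63}` give `DyadicTwistLevelManinOne M d` for
every `d ∈ {−1, ±2}`: `|c| = 1` (so `2 ∤ c` AND `3 ∤ c`) on the `d`-twist images — newform levels `432 = 2⁴·3³`, `1728 = 2⁶·3³`,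
`720`, `2880`, `1008`, `4032`, additive at BOTH `2` and `3`, inside BOTH crux domains — and then (T-desc-55's 68.A on top) their odd-twist
families, unbounded conductor.  PER-CLASS CLOSURE (THEOREM 69.C, `abs_maninConstant_eq_one_of_twoTwist_of_newformManinOne`).

HONEST SCOPE.  Nothing here proves C2, C3, Manin's conjecture or BSD.  Instantiating a member class needs its lattice-optimal datum (EXO +
modularity of the class) and additivity at `2` of the member.  Source: `HOME/desc/g44/Sketch-desc-g44.lean` (sha16 05beaaff6d6eee16,
farm rc 0) §1–§4; §0 and the predicates `LevelManinOne` / `NewformManinOne` are IMPORTED from `…TwistFamiliesFactFree` (T-desc-55).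
[cite: Stevens1989, Lemma (5.2) p. 96, Lemma (5.4) p. 97, (5.6)–(5.7) p. 98] [cite: Pal2012, Prop. 2.4, Lemma 3.1]
[cite: Shimura1971, Prop. 3.64] [cite: EdixhovenManin1991, Prop. 2] [cite: Cremona1997, §2.8, §2.10]
-/

set_option autoImplicit false
set_option linter.dupNamespace false

noncomputable section

open scoped Classical NumberField MatrixGroups ModularForm

namespace Summit.BirchSwinnertonDyer.BirchSwinnertonDyer.Theorems.ManinLocalTwoThree.DyadicTwistFamilies

open WeierstrassCurve CongruenceSubgroup IsDedekindDomain IsDedekindDomain.HeightOneSpectrum Rat.HeightOneSpectrum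
  Literature.NumberTheory.Automorphic
  Literature.NumberTheory.EllipticCurves Literature.NumberTheory.EllipticCurves.ModularForms
  Summit.BirchSwinnertonDyer.BirchSwinnertonDyer.Theorems
  Summit.BirchSwinnertonDyer.BirchSwinnertonDyer.Theorems.ManinLocalTwoThree
  Summit.BirchSwinnertonDyer.BirchSwinnertonDyer.Theorems.ManinLocalTwoThree.ExistsMinimalOptimalDatum
  Summit.BirchSwinnertonDyer.BirchSwinnertonDyer.Theorems.ManinLocalTwoThree.TwistFamilies
  Summit.BirchSwinnertonDyer.Rank1Residual.ManinAdditive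

/-! ## §1 THE ENGINE (THEOREM 69.A): `|c| = 1` ascends along a dyadic twist of a `2`-semistable root -/

/-- **69.A, Stevens' case `η = 1`, generic character.** `W` globally minimal with an `X₀(M)`-datum `D`,
`|c(D)| = 1`, good or multiplicative at `2`, and (`d = −1` or `W` multiplicative at `2` or `a₂(W)` odd);
`χ` primitive quadratic mod `m` with `g(χ)² = 4d`; `W'` globally minimal with a lattice-optimal
`X₀(N)`-datum `D'`, `M ∣ N`, `m² ∣ N`, `aₙ(D'.f) = χ(n)·aₙ(D.f)`.  Then `|c(D')| = 1`: a minimal model `C`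
of `W ⊗ ℚ(√d)` with Néron pair `Λ_C = g(χ)⁻¹Λ_W` (Stevens (5.2) at `2`, PROVED), the `Γ₀` twist step
`c(D') ∣ c(D)` (PROVED), §0. [cite: Stevens1989, Lemma (5.2) p. 96, Lemma (5.4) p. 97] [cite: Pal2012, Prop. 2.4] -/
theorem abs_maninConstant_eq_one_of_twoTwist_etaOne_of_char
    {d : ℤ} (hd : d = -1 ∨ d = 2 ∨ d = -2)
    {m : ℕ} [NeZero m] {χ : DirichletCharacter ℂ m} (hχ : χ.IsQuadratic) (hprim : χ.IsPrimitive)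
    (hG : gaussSum χ (ZMod.stdAddChar (N := m)) ^ 2 = ((4 * d : ℤ) : ℂ))
    {W : WeierstrassCurve ℚ} [W.IsElliptic] [W.IsGloballyMinimal] {M : ℕ} [NeZero M]
    (D : ModularParametrizationData W M) (hD : |D.maninConstant| = 1)
    (hsemi : W.HasGoodReductionAtPrime 2 ∨ W.HasMultiplicativeReductionAtPrime 2)
    (hη : d = -1 ∨ W.HasMultiplicativeReductionAtPrime 2 ∨ Odd (W.LFunction 2))
    {W' : WeierstrassCurve ℚ} [W'.IsElliptic] [W'.IsGloballyMinimal] {N : ℕ} [NeZero N]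
    (D' : ModularParametrizationData W' N) (hMN : M ∣ N) (hmN : m ^ 2 ∣ N)
    (hf : ∀ n : ℕ, cuspCoeff D'.f n = χ n * cuspCoeff D.f n)
    (hopt' : ∀ z ∈ D'.L.lattice, ∃ w ∈ periodLattice D'.f, z = D'.c * w) :
    |D'.maninConstant| = 1 := by
  have hdZ : d ≠ 0 := by rcases hd with rfl | rfl | rfl <;> norm_num
  have hd0 : (d : ℚ) ≠ 0 := by exact_mod_cast hdZ
  haveI : (W.quadraticTwist (d : ℚ)).IsElliptic := W.isElliptic_quadraticTwist hd0
  -- a minimal model `C` of `W ⊗ ℚ(√d)` and a Néron pair of it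
  obtain ⟨vC, hvC⟩ := hasGlobalMinimalModel_rat_holds (W.quadraticTwist (d : ℚ))
  haveI := hvC
  haveI : ((vC • W.quadraticTwist (d : ℚ)).baseChange ℂ).IsElliptic := by
    rw [WeierstrassCurve.baseChange]; infer_instance
  obtain ⟨LC, hC⟩ := exists_isNeronLatticeOf_holds ((vC • W.quadraticTwist (d : ℚ)).baseChange ℂ)
  -- Stevens (5.2) at `2`, `η = 1`: `Λ_C = g(χ)⁻¹ Λ_W`
  have hLC : ∀ z : ℂ, z ∈ LC.lattice ↔ gaussSum χ (ZMod.stdAddChar (N := m)) * z ∈ D.L.lattice :=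
    fun z ↦ neronLattice_quadraticTwist_two_of_etaOne D.isNeronLattice hd hsemi hη
      (vC • W.quadraticTwist (d : ℚ)) ⟨vC, rfl⟩ hC hG z
  -- the `Γ₀` twist step
  have hdvd : D'.c ∣ D.c := maninConstant_dvd_of_charTwist_gamma0 D D' hopt' hχ hprim hMN hmN hf hC hLC
  exact abs_eq_one_of_dvd_of_abs_eq_one hdvd hD

/-- **69.A, Stevens' case `η = 2`** (`d = ±2`, `W` GOOD at `2` with `a₂(W)` even, ODD level `M`), generic
character mod `8` with the sum shape `F(1) + εF(3) − F(5) − εF(7)`: `|c(D')| = 1`, by seat p3's E-an-1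
route run to `c(D') ∣ c(D)` — K2 (`W ⊗ ℚ(√d)` is globally minimal), K1 (`(g(χ)/2)·Λ(f_D ⊗ χ) ⊆ Λ(f_D)`,
Hecke at `2` on `Γ₀(M)`, `2 ∤ M`), `Λ_{W⊗d} = (g/2)⁻¹Λ_W`, engine `maninConstant_dvd_mul_of_twistStep`
with `r = 1`. [cite: Stevens1989, Lemma (5.4) p. 97, (5.6)–(5.7) p. 98] [cite: Pal2012, Lemma 3.1] -/
theorem abs_maninConstant_eq_one_of_twoTwist_etaTwo_of_char
    {d : ℤ} (hd : d = 2 ∨ d = -2)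
    {χ : DirichletCharacter ℂ 8} (hχ : χ.IsQuadratic) (hprim : χ.IsPrimitive)
    (hG : gaussSum χ (ZMod.stdAddChar (N := 8)) ^ 2 = ((4 * d : ℤ) : ℂ))
    {ε : ℤ} (hε : ε = 1 ∨ ε = -1)
    (hχsum : ∀ F : ZMod 8 → ℂ, ∑ u : ZMod 8, χ u * F u = F 1 + ε * F 3 - F 5 - ε * F 7)
    {W : WeierstrassCurve ℚ} [W.IsElliptic] [W.IsGloballyMinimal] {M : ℕ} [NeZero M]
    (D : ModularParametrizationData W M) (hD : |D.maninConstant| = 1) (h2M : ¬ 2 ∣ M)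
    (hgood : W.HasGoodReductionAtPrime 2) (hss : Even (W.LFunction 2))
    {W' : WeierstrassCurve ℚ} [W'.IsElliptic] [W'.IsGloballyMinimal] {N : ℕ} [NeZero N]
    (D' : ModularParametrizationData W' N) (hMN : M ∣ N) (hmN : 8 ^ 2 ∣ N)
    (hf : ∀ n : ℕ, cuspCoeff D'.f n = χ n * cuspCoeff D.f n)
    (hopt' : ∀ z ∈ D'.L.lattice, ∃ w ∈ periodLattice D'.f, z = D'.c * w) :
    |D'.maninConstant| = 1 := by
  have hdZ : d ≠ 0 := by rcases hd with rfl | rfl <;> norm_num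
  have hd0 : (d : ℚ) ≠ 0 := by exact_mod_cast hdZ
  haveI : (W.quadraticTwist (d : ℚ)).IsElliptic := W.isElliptic_quadraticTwist hd0
  -- K2: `W ⊗ ℚ(√d)` is globally minimal
  haveI : (W.quadraticTwist (d : ℚ)).IsGloballyMinimal :=
    isGloballyMinimal_quadraticTwist_two_of_even_LFunction_two W hd hgood hss
  have hG0 : gaussSum χ (ZMod.stdAddChar (N := 8)) ≠ 0 :=
    gaussSum_stdAddChar_ne_zero_of_isPrimitive hprim
  have hs0 : gaussSum χ (ZMod.stdAddChar (N := 8)) / 2 ≠ 0 := div_ne_zero hG0 two_ne_zero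
  have hs2 : (gaussSum χ (ZMod.stdAddChar (N := 8)) / 2) ^ 2 = ((d : ℚ) : ℂ) := by
    rw [div_pow, hG]
    push_cast
    ring
  -- `Λ_{W ⊗ d} = (g/2)⁻¹ Λ_W`
  have hC : IsNeronLatticeOf ((W.quadraticTwist (d : ℚ)).baseChange ℂ)
      (D.L.mulLeft (gaussSum χ (ZMod.stdAddChar (N := 8)) / 2)⁻¹ (inv_ne_zero hs0)) :=
    isNeronLatticeOf_quadraticTwist_of_sq_eq (d : ℚ) D.isNeronLattice hs0 hs2
  have hLC : ∀ z : ℂ, gaussSum χ (ZMod.stdAddChar (N := 8)) / 2 * z ∈ D.L.lattice →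
      ((1 : ℤ) : ℂ) * z ∈
        (D.L.mulLeft (gaussSum χ (ZMod.stdAddChar (N := 8)) / 2)⁻¹ (inv_ne_zero hs0)).lattice := by
    intro z hz
    rw [PeriodPair.mem_mulLeft_lattice, inv_inv, Int.cast_one, one_mul]
    exact hz
  -- K1: Hecke at `2` on the odd level `M`, even eigenvalue `2k`
  obtain ⟨k, hk⟩ := hss
  have hT₂ : ∀ r : ℚ, (2 * k : ℂ) * modularSymbol D.f r =
      ∑ j : Fin 2, modularSymbol D.f ((r + j) / 2) + modularSymbol D.f (2 * r) := by
    intro r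
    have h := cuspCoeff_mul_modularSymbol 2 D.isNewformOf.1 Nat.prime_two h2M r
    rw [D.isNewformOf.2 2, hk] at h
    push_cast at h
    rw [show (k : ℂ) + k = 2 * k by ring] at h
    exact h
  have hstep : ∀ w ∈ periodLattice (charTwist N hMN hmN hχ D.f),
      gaussSum χ (ZMod.stdAddChar (N := 8)) / 2 * w ∈ periodLattice D.f :=
    fun w hw ↦ half_gaussSum_mul_mem_periodLattice_of_heckeTwo N hMN hmN hχ hprim hε hχsum D.f h2M k
      hT₂ hw
  -- the engine, `r = 1`
  have hdvd : D'.c ∣ 1 * D.c :=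
    maninConstant_dvd_mul_of_twistStep D D' hopt' hχ hprim hMN hmN hf
      (gaussSum χ (ZMod.stdAddChar (N := 8)) / 2) hstep hC 1 hLC
  rw [one_mul] at hdvd
  exact abs_eq_one_of_dvd_of_abs_eq_one hdvd hD

/-- The twisted newform: if `W'` is ADDITIVE at `2` and isogenous to `W ⊗ ℚ(√d)`, and
`aₙ(W ⊗ d) = χ(n) aₙ(W)` for odd `n`, `χ(even) = 0`, then `aₙ(D'.f) = χ(n) aₙ(D.f)` for ALL `n`
(`IsNewformOf` of both data, `L`-function of an isogeny class, `a_{2k}(W') = 0`). [elementary] -/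
theorem cuspCoeff_eq_chi_mul_of_isIsogenous_twist
    {m : ℕ} {χ : DirichletCharacter ℂ m} {d : ℤ} (hd0 : (d : ℚ) ≠ 0)
    {W : WeierstrassCurve ℚ} [W.IsElliptic] {M : ℕ} [NeZero M] (D : ModularParametrizationData W M)
    (hχodd : ∀ n : ℕ, ¬ 2 ∣ n →
      (((W.quadraticTwist (d : ℚ)).LFunction n : ℤ) : ℂ) = χ n * ((W.LFunction n : ℤ) : ℂ))
    (hχeven : ∀ n : ℕ, 2 ∣ n → χ n = 0)
    {W' : WeierstrassCurve ℚ} [W'.IsElliptic] {N : ℕ} [NeZero N] (D' : ModularParametrizationData W' N)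
    (htw : IsIsogenous W' (W.quadraticTwist (d : ℚ)))
    (hadd' : ¬ W'.HasGoodReductionAtPrime 2 ∧ ¬ W'.HasMultiplicativeReductionAtPrime 2) :
    ∀ n : ℕ, cuspCoeff D'.f n = χ n * cuspCoeff D.f n := by
  haveI : Fact (Nat.Prime 2) := ⟨Nat.prime_two⟩
  haveI : (W.quadraticTwist (d : ℚ)).IsElliptic := W.isElliptic_quadraticTwist hd0
  have hLtw : W'.LFunction = (W.quadraticTwist (d : ℚ)).LFunction :=
    LFunction_eq_of_isIsogenous_holds _ _ htw
  intro n
  rw [D'.isNewformOf.2 n, D.isNewformOf.2 n]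
  by_cases h2n : 2 ∣ n
  · have h0 : W'.LFunction n = 0 :=
      W'.LFunction_apply_eq_zero_of_not_good_of_not_mult 2 hadd'.1 hadd'.2 h2n
    rw [h0, hχeven n h2n]
    simp
  · have hLn : W'.LFunction n = (W.quadraticTwist (d : ℚ)).LFunction n := by rw [hLtw]
    rw [hLn, hχodd n h2n]

/-- **THEOREM 69.A — dyadic twist propagation of `|c| = 1`, NO NAMED FACT, curve-level form.**  `W`
globally minimal with an `X₀(M)`-datum `D`, `|c(D)| = 1`, good or multiplicative at `2`; `d ∈ {−1, 2, −2}`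
with Stevens' clause `d = −1 ∨ W multiplicative at 2 ∨ a₂(W) odd ∨ 2 ∤ M`; `W'` globally minimal,
ADDITIVE at `2`, isogenous over `ℚ` to `W ⊗ ℚ(√d)`, with a lattice-optimal `X₀(N)`-datum `D'`, `M ∣ N`,
`(4|d|)² ∣ N`.  Then `|c(D')| = 1`.  Dispatch: `χ₋₄ / χ₈ / χ₋₈` (`g² = 4d`), `η = 1` unless
`d = ±2`, `W` good at `2`, `a₂(W)` even, where `η = 2` on the odd level `M`.
[cite: Stevens1989, Lemmas (5.2), (5.4), (5.6)–(5.7)] [cite: Pal2012, Prop. 2.4, Lemma 3.1] -/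
theorem abs_maninConstant_eq_one_of_twoTwist {d : ℤ} (hd : d = -1 ∨ d = 2 ∨ d = -2)
    {W : WeierstrassCurve ℚ} [W.IsElliptic] [W.IsGloballyMinimal] {M : ℕ} [NeZero M]
    (D : ModularParametrizationData W M) (hD : |D.maninConstant| = 1)
    (hsemi : W.HasGoodReductionAtPrime 2 ∨ W.HasMultiplicativeReductionAtPrime 2)
    (hη : d = -1 ∨ W.HasMultiplicativeReductionAtPrime 2 ∨ Odd (W.LFunction 2) ∨ ¬ 2 ∣ M)
    {W' : WeierstrassCurve ℚ} [W'.IsElliptic] [W'.IsGloballyMinimal] {N : ℕ} [NeZero N]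
    (D' : ModularParametrizationData W' N) (hMN : M ∣ N) (hmN : (4 * d.natAbs) ^ 2 ∣ N)
    (htw : IsIsogenous W' (W.quadraticTwist (d : ℚ)))
    (hadd' : ¬ W'.HasGoodReductionAtPrime 2 ∧ ¬ W'.HasMultiplicativeReductionAtPrime 2)
    (hopt' : ∀ z ∈ D'.L.lattice, ∃ w ∈ periodLattice D'.f, z = D'.c * w) :
    |D'.maninConstant| = 1 := by
  have hdZ : d ≠ 0 := by rcases hd with rfl | rfl | rfl <;> norm_num
  have hd0 : (d : ℚ) ≠ 0 := by exact_mod_cast hdZ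
  by_cases hη1 : d = -1 ∨ W.HasMultiplicativeReductionAtPrime 2 ∨ Odd (W.LFunction 2)
  · -- `η = 1`
    rcases hd with rfl | rfl | rfl
    · refine abs_maninConstant_eq_one_of_twoTwist_etaOne_of_char (d := -1) (Or.inl rfl)
        isQuadratic_χ₄_ringHomComp isPrimitive_χ₄_ringHomComp
        (by rw [gaussSum_χ₄_ringHomComp_sq]; norm_num) D hD hsemi hη1 D' hMN (by simpa using hmN)
        (cuspCoeff_eq_chi_mul_of_isIsogenous_twist hd0 D (fun n hn ↦ ?_) (fun n hn ↦ ?_) D' htw hadd')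
        hopt'
      · rw [show ((-1 : ℤ) : ℚ) = -1 by norm_num, W.LFunction_quadraticTwist_neg_one_apply_of_odd hn,
          Int.cast_mul, χ₄_ringHomComp_apply_natCast]
      · rw [χ₄_ringHomComp_apply_natCast, ZMod.χ₄_nat_eq_if_mod_four, if_pos (Nat.mod_eq_zero_of_dvd hn)]
        simp
    · refine abs_maninConstant_eq_one_of_twoTwist_etaOne_of_char (d := 2) (Or.inr (Or.inl rfl))
        isQuadratic_χ₈_ringHomComp isPrimitive_χ₈_ringHomComp
        (by rw [gaussSum_χ₈_ringHomComp_sq]; norm_num) D hD hsemi hη1 D' hMN (by simpa using hmN)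
        (cuspCoeff_eq_chi_mul_of_isIsogenous_twist hd0 D (fun n hn ↦ ?_) (fun n hn ↦ ?_) D' htw hadd')
        hopt'
      · rw [show ((2 : ℤ) : ℚ) = 2 by norm_num, W.LFunction_quadraticTwist_two_apply_of_odd hn,
          Int.cast_mul, χ₈_ringHomComp_apply_natCast]
      · rw [χ₈_ringHomComp_apply_natCast, ZMod.χ₈_nat_eq_if_mod_eight,
          if_pos (Nat.mod_eq_zero_of_dvd hn)]
        simp
    · refine abs_maninConstant_eq_one_of_twoTwist_etaOne_of_char (d := -2) (Or.inr (Or.inr rfl))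
        isQuadratic_χ₈'_ringHomComp isPrimitive_χ₈'_ringHomComp
        (by rw [gaussSum_χ₈'_ringHomComp_sq]; norm_num) D hD hsemi hη1 D' hMN (by simpa using hmN)
        (cuspCoeff_eq_chi_mul_of_isIsogenous_twist hd0 D (fun n hn ↦ ?_) (fun n hn ↦ ?_) D' htw hadd')
        hopt'
      · rw [show ((-2 : ℤ) : ℚ) = -2 by norm_num, W.LFunction_quadraticTwist_neg_two_apply_of_odd hn,
          Int.cast_mul, χ₈'_ringHomComp_apply_natCast]
      · rw [χ₈'_ringHomComp_apply_natCast, ZMod.χ₈'_nat_eq_if_mod_eight,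
          if_pos (Nat.mod_eq_zero_of_dvd hn)]
        simp
  · -- `η = 2`: `d = ±2`, `W` good at `2`, `a₂(W)` even, `2 ∤ M`
    push Not at hη1
    obtain ⟨hd1, hmult, hodd⟩ := hη1
    have h2M : ¬ 2 ∣ M := by
      rcases hη with h | h | h | h
      · exact absurd h hd1
      · exact absurd h hmult
      · exact absurd h hodd
      · exact h
    have hgood : W.HasGoodReductionAtPrime 2 := hsemi.resolve_right hmult
    have hss : Even (W.LFunction 2) := Int.not_odd_iff_even.mp hodd
    have hd' : d = 2 ∨ d = -2 := by
      rcases hd with h | h | h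
      · exact absurd h hd1
      · exact Or.inl h
      · exact Or.inr h
    have hmN' : 8 ^ 2 ∣ N := by
      have habs : d.natAbs = 2 := by rcases hd' with rfl | rfl <;> rfl
      rw [habs] at hmN
      simpa using hmN
    rcases hd' with rfl | rfl
    · refine abs_maninConstant_eq_one_of_twoTwist_etaTwo_of_char (Or.inl rfl)
        isQuadratic_χ₈_ringHomComp isPrimitive_χ₈_ringHomComp
        (by rw [gaussSum_χ₈_ringHomComp_sq]; norm_num) (ε := -1) (Or.inr rfl) sum_χ₈_shape
        D hD h2M hgood hss D' hMN hmN'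
        (cuspCoeff_eq_chi_mul_of_isIsogenous_twist hd0 D (fun n hn ↦ ?_) (fun n hn ↦ ?_) D' htw hadd')
        hopt'
      · rw [show ((2 : ℤ) : ℚ) = 2 by norm_num, W.LFunction_quadraticTwist_two_apply_of_odd hn,
          Int.cast_mul, χ₈_ringHomComp_apply_natCast]
      · rw [χ₈_ringHomComp_apply_natCast, ZMod.χ₈_nat_eq_if_mod_eight,
          if_pos (Nat.mod_eq_zero_of_dvd hn)]
        simp
    · refine abs_maninConstant_eq_one_of_twoTwist_etaTwo_of_char (Or.inr rfl)
        isQuadratic_χ₈'_ringHomComp isPrimitive_χ₈'_ringHomComp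
        (by rw [gaussSum_χ₈'_ringHomComp_sq]; norm_num) (ε := 1) (Or.inl rfl) sum_χ₈'_shape
        D hD h2M hgood hss D' hMN hmN'
        (cuspCoeff_eq_chi_mul_of_isIsogenous_twist hd0 D (fun n hn ↦ ?_) (fun n hn ↦ ?_) D' htw hadd')
        hopt'
      · rw [show ((-2 : ℤ) : ℚ) = -2 by norm_num, W.LFunction_quadraticTwist_neg_two_apply_of_odd hn,
          Int.cast_mul, χ₈'_ringHomComp_apply_natCast]
      · rw [χ₈'_ringHomComp_apply_natCast, ZMod.χ₈'_nat_eq_if_mod_eight,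
          if_pos (Nat.mod_eq_zero_of_dvd hn)]
        simp

/-- **E-desc-228 `DyadicTwistLevelManinOne M d`** — `|c| = 1` ON THE `d`-TWIST IMAGE OF LEVEL `M` AT THE
PRIME `2` (`d ∈ {−1, 2, −2}`): for every lattice-optimal `X₀(M)`-datum `D` on a globally minimal curve `W`
good or multiplicative at `2` satisfying Stevens' clause (`d = −1 ∨ W mult at 2 ∨ a₂(W) odd ∨ 2 ∤ M`),
and every globally minimal `W'` ADDITIVE at `2`, isogenous to `W ⊗ ℚ(√d)`, with a lattice-optimal
`X₀(N)`-datum `D'` (`M ∣ N`, `(4|d|)² ∣ N`): `|c(D')| = 1`.  THEOREM for every complete `M` (§3).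
[cite: Stevens1989, Lemma (5.2), (5.4), (5.6)–(5.7)] [cite: Pal2012, Prop. 2.4] -/
def DyadicTwistLevelManinOne (M : ℕ) [NeZero M] (d : ℤ) : Prop :=
  ∀ (W : WeierstrassCurve ℚ) [W.IsElliptic] [W.IsGloballyMinimal] (D : ModularParametrizationData W M),
    (∀ z ∈ D.L.lattice, ∃ w ∈ periodLattice D.f, z = D.c * w) →
    (W.HasGoodReductionAtPrime 2 ∨ W.HasMultiplicativeReductionAtPrime 2) →
    (d = -1 ∨ W.HasMultiplicativeReductionAtPrime 2 ∨ Odd (W.LFunction 2) ∨ ¬ 2 ∣ M) →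
  ∀ (W' : WeierstrassCurve ℚ) [W'.IsElliptic] [W'.IsGloballyMinimal] (N : ℕ) [NeZero N]
    (D' : ModularParametrizationData W' N), M ∣ N → (4 * d.natAbs) ^ 2 ∣ N →
    IsIsogenous W' (W.quadraticTwist (d : ℚ)) →
    (¬ W'.HasGoodReductionAtPrime 2 ∧ ¬ W'.HasMultiplicativeReductionAtPrime 2) →
    (∀ z ∈ D'.L.lattice, ∃ w ∈ periodLattice D'.f, z = D'.c * w) → |D'.maninConstant| = 1

/-- **LevelManinOne ⇒ DyadicTwistLevelManinOne for every `d ∈ {−1, ±2}`** (THEOREM 69.A, universally). -/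
theorem dyadicTwistLevelManinOne_of_levelManinOne {M : ℕ} [NeZero M] (hM : LevelManinOne M)
    {d : ℤ} (hd : d = -1 ∨ d = 2 ∨ d = -2) : DyadicTwistLevelManinOne M d := by
  intro W _ _ D hopt hsemi hη W' _ _ N _ D' hMN hmN htw hadd' hopt'
  exact abs_maninConstant_eq_one_of_twoTwist hd D (hM W D hopt) hsemi hη D' hMN hmN htw hadd' hopt'

/-- **THEOREM 69.C — per-class closure under dyadic twists of a GOOD root at an ODD level.**  If every
lattice-optimal datum with newform `D₀.f` (`D₀` any `X₀(M)`-datum of any elliptic `W₀` good at `2`,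
`2 ∤ M`) has `|c| = 1`, then so does every lattice-optimal datum on any globally minimal `W'` additive
at `2` and isogenous to `W₀ ⊗ ℚ(√d)` (`M ∣ N`, `(4|d|)² ∣ N`).  Extra inputs: EXO
(`existsMinimalOptimalDatum_full`, unconditional), `IsIsogenous.hasGoodReductionAtPrime_iff`,
`IsIsogenous.quadraticTwist`. [cite: EdixhovenManin1991, Prop. 2] [cite: SilvermanAEC2009, Cor. VII.7.2] -/
theorem abs_maninConstant_eq_one_of_twoTwist_of_newformManinOne {d : ℤ} (hd : d = -1 ∨ d = 2 ∨ d = -2)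
    {W₀ : WeierstrassCurve ℚ} [W₀.IsElliptic] {M : ℕ} [NeZero M] (D₀ : ModularParametrizationData W₀ M)
    (hgood : W₀.HasGoodReductionAtPrime 2) (h2M : ¬ 2 ∣ M) (h : NewformManinOne D₀.f)
    {W' : WeierstrassCurve ℚ} [W'.IsElliptic] [W'.IsGloballyMinimal] {N : ℕ} [NeZero N]
    (D' : ModularParametrizationData W' N) (hMN : M ∣ N) (hmN : (4 * d.natAbs) ^ 2 ∣ N)
    (htw : IsIsogenous W' (W₀.quadraticTwist (d : ℚ)))
    (hadd' : ¬ W'.HasGoodReductionAtPrime 2 ∧ ¬ W'.HasMultiplicativeReductionAtPrime 2)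
    (hopt' : ∀ z ∈ D'.L.lattice, ∃ w ∈ periodLattice D'.f, z = D'.c * w) :
    |D'.maninConstant| = 1 := by
  haveI : Fact (Nat.Prime 2) := ⟨Nat.prime_two⟩
  have hdZ : d ≠ 0 := by rcases hd with rfl | rfl | rfl <;> norm_num
  have hd0 : (d : ℚ) ≠ 0 := by exact_mod_cast hdZ
  obtain ⟨W₁, hE₁, hM₁, D₁, hf₁, hiso, hopt₁, -⟩ := existsMinimalOptimalDatum_full W₀ D₀
  haveI := hE₁
  haveI := hM₁
  have hD₁ : |D₁.maninConstant| = 1 := h W₁ D₁ hf₁ hopt₁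
  have hgood₁ : W₁.HasGoodReductionAtPrime 2 := (hiso.hasGoodReductionAtPrime_iff 2).mp hgood
  have htw₁ : IsIsogenous W' (W₁.quadraticTwist (d : ℚ)) :=
    IsIsogenous.trans' htw (hiso.quadraticTwist hd0)
  exact abs_maninConstant_eq_one_of_twoTwist hd D₁ hD₁ (Or.inl hgood₁) (Or.inr (Or.inr (Or.inr h2M)))
    D' hMN hmN htw₁ hadd' hopt'

/-- **THEOREM 69.B — the twelve dyadic twist families of the `2`-semistable complete levels, NO NAMED
FACT.**  For every `d ∈ {−1, 2, −2}`: `|c| = 1` on the `d`-twist images of the complete levels `27`, `45`,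
`54`, `63` (newform levels `432, 720, 1008` for `d = −1` and `1728, 2880, 4032` for `d = ±2`; their multiples `N`). -/
theorem dyadicTwistLevelManinOne_families {d : ℤ} (hd : d = -1 ∨ d = 2 ∨ d = -2) :
    DyadicTwistLevelManinOne 27 d ∧ DyadicTwistLevelManinOne 45 d ∧ DyadicTwistLevelManinOne 54 d ∧
      DyadicTwistLevelManinOne 63 d :=
  ⟨dyadicTwistLevelManinOne_of_levelManinOne levelManinOne_twentySeven hd,
   dyadicTwistLevelManinOne_of_levelManinOne levelManinOne_fortyFive hd,
   dyadicTwistLevelManinOne_of_levelManinOne levelManinOne_fiftyFour hd,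
   dyadicTwistLevelManinOne_of_levelManinOne levelManinOne_sixtyThree hd⟩

/-! ## §4 The C2 ∧ C3 shapes on the dyadic families (levels additive at BOTH `2` and `3`) -/

/-- **C2-shape (`2 ∤ c`) AND C3-shape (`3 ∤ c`) on a dyadic twist image**: `DyadicTwistLevelManinOne M d`
gives `|c(D')| = 1 ∧ 2 ∤ c(D') ∧ 3 ∤ c(D')` — the conclusions of BOTH cruxes `ManinOddAtFour` (`4 ∣ N`) and
`ManinPrimeToThreeAtNine` (`27 ∣ N` for `M ∈ {27, 54}`, `9 ∥ N` for `M = 45`) on these classes with NONE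
of their printed hypotheses. -/
theorem shapes_of_dyadicTwistLevelManinOne {M : ℕ} [NeZero M] {d : ℤ}
    (h : DyadicTwistLevelManinOne M d)
    (W : WeierstrassCurve ℚ) [W.IsElliptic] [W.IsGloballyMinimal] (D : ModularParametrizationData W M)
    (hopt : ∀ z ∈ D.L.lattice, ∃ w ∈ periodLattice D.f, z = D.c * w)
    (hsemi : W.HasGoodReductionAtPrime 2 ∨ W.HasMultiplicativeReductionAtPrime 2)
    (hη : d = -1 ∨ W.HasMultiplicativeReductionAtPrime 2 ∨ Odd (W.LFunction 2) ∨ ¬ 2 ∣ M)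
    (W' : WeierstrassCurve ℚ) [W'.IsElliptic] [W'.IsGloballyMinimal] (N : ℕ) [NeZero N]
    (D' : ModularParametrizationData W' N) (hMN : M ∣ N) (hmN : (4 * d.natAbs) ^ 2 ∣ N)
    (htw : IsIsogenous W' (W.quadraticTwist (d : ℚ)))
    (hadd' : ¬ W'.HasGoodReductionAtPrime 2 ∧ ¬ W'.HasMultiplicativeReductionAtPrime 2)
    (hopt' : ∀ z ∈ D'.L.lattice, ∃ w ∈ periodLattice D'.f, z = D'.c * w) :
    |D'.maninConstant| = 1 ∧ ¬ (2 : ℤ) ∣ D'.maninConstant ∧ ¬ (3 : ℤ) ∣ D'.maninConstant :=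
  have h1 := h W D hopt hsemi hη W' N D' hMN hmN htw hadd' hopt'
  ⟨h1, not_dvd_of_abs_eq_one h1 (by decide), not_dvd_of_abs_eq_one h1 (by decide)⟩

/-- **`27a ⊗ χ₋₄` (level `432 = 2⁴·3³`)**: `|c(D')| = 1 ∧ 2 ∤ c ∧ 3 ∤ c` for every lattice-optimal `X₀(432)`-datum `D'` of a globally
minimal `W'` additive at `2` and isogenous to the `−1`-twist of a `2`-semistable carrier of a lattice-optimal `X₀(27)`-datum. -/
theorem shapes_on_family_twentySeven_negOne
    (W : WeierstrassCurve ℚ) [W.IsElliptic] [W.IsGloballyMinimal] (D : ModularParametrizationData W 27)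
    (hopt : ∀ z ∈ D.L.lattice, ∃ w ∈ periodLattice D.f, z = D.c * w)
    (hsemi : W.HasGoodReductionAtPrime 2 ∨ W.HasMultiplicativeReductionAtPrime 2)
    (W' : WeierstrassCurve ℚ) [W'.IsElliptic] [W'.IsGloballyMinimal] [NeZero (432 : ℕ)]
    (D' : ModularParametrizationData W' 432)
    (htw : IsIsogenous W' (W.quadraticTwist ((-1 : ℤ) : ℚ)))
    (hadd' : ¬ W'.HasGoodReductionAtPrime 2 ∧ ¬ W'.HasMultiplicativeReductionAtPrime 2)
    (hopt' : ∀ z ∈ D'.L.lattice, ∃ w ∈ periodLattice D'.f, z = D'.c * w) :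
    |D'.maninConstant| = 1 ∧ ¬ (2 : ℤ) ∣ D'.maninConstant ∧ ¬ (3 : ℤ) ∣ D'.maninConstant :=
  shapes_of_dyadicTwistLevelManinOne (dyadicTwistLevelManinOne_families (Or.inl rfl)).1 W D hopt hsemi
    (Or.inl rfl) W' 432 D' (by norm_num) (by norm_num) htw hadd' hopt'

/-- **`45a ⊗ χ±8` (level `2880 = 2⁶·3²·5`)**: the same on the `±2`-twist image of level `45` (`9 ∥ N`). -/
theorem shapes_on_family_fortyFive_two {d : ℤ} (hd : d = 2 ∨ d = -2)
    (W : WeierstrassCurve ℚ) [W.IsElliptic] [W.IsGloballyMinimal] (D : ModularParametrizationData W 45)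
    (hopt : ∀ z ∈ D.L.lattice, ∃ w ∈ periodLattice D.f, z = D.c * w)
    (hsemi : W.HasGoodReductionAtPrime 2 ∨ W.HasMultiplicativeReductionAtPrime 2)
    (W' : WeierstrassCurve ℚ) [W'.IsElliptic] [W'.IsGloballyMinimal] [NeZero (2880 : ℕ)]
    (D' : ModularParametrizationData W' 2880)
    (htw : IsIsogenous W' (W.quadraticTwist (d : ℚ)))
    (hadd' : ¬ W'.HasGoodReductionAtPrime 2 ∧ ¬ W'.HasMultiplicativeReductionAtPrime 2)
    (hopt' : ∀ z ∈ D'.L.lattice, ∃ w ∈ periodLattice D'.f, z = D'.c * w) :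
    |D'.maninConstant| = 1 ∧ ¬ (2 : ℤ) ∣ D'.maninConstant ∧ ¬ (3 : ℤ) ∣ D'.maninConstant :=
  have hd3 : d = -1 ∨ d = 2 ∨ d = -2 := Or.inr hd
  have habs : (4 * d.natAbs) ^ 2 = 64 := by rcases hd with rfl | rfl <;> rfl
  shapes_of_dyadicTwistLevelManinOne (dyadicTwistLevelManinOne_families hd3).2.1 W D hopt hsemi
    (Or.inr (Or.inr (Or.inr (by norm_num)))) W' 2880 D' (by norm_num) (by rw [habs]; norm_num) htw hadd' hopt'

end Summit.BirchSwinnertonDyer.BirchSwinnertonDyer.Theorems.ManinLocalTwoThree.DyadicTwistFamilies
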